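import Summits.MatrixMultiplication.MatrixMultiplication.Theorems.SoloInformedValTwoBlockCount

/-!
# Three-term face inequalities for hub pairs: a block with two rows and a side `≤ 2` packs linearly

Solo-informed MatrixMultiplication, gen 81 (dossier `paper/val-superlinear.md` §15.8 (n)), a sequel to the
face inequalities of `SoloInformedValTwoBlockFaces` / `…FacesB` (gen 77) and to `SoloInformedValTwoRowHubPair`.

A HUB PAIR is a pair of complete blocks `X₁ × Y₁ × Z₁`, `X₂ × Y₂ × Z₂` (identity potentials in an abelian group
`G`, pair graphs `blockPairs`) with `Y₁ ∩ Y₂ = ∅ = Z₁ ∩ Z₂` whose row classes SHARE an element `h ∈ X₁ ∩ X₂` (the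
hub; `X₁ ∩ X₂` may be larger, nothing below uses more than one common row).  If the union is accidental-free,
three images are pairwise disjoint:

* `S = {x + y - z : (x, y, z) ∈ X₁ × Y₁ × Z₁}` — `|S| = |X₁||Y₁||Z₁|` (block 1 is a TPP block);
* `P = {h + y - z : (y, z) ∈ Y₂ × Z₂}` — `|P| = |Y₂||Z₂|` (the hub sees `Y₂` and `Z₂`);
* `N = {x + y₀ - z : (x, z) ∈ X₂ × Z₂}` for a fixed `y₀ ∈ Y₁` — `|N| = |X₂||Z₂|` (block 2 is a TPP block);

each coincidence between two of them is an accidental solution whose `IJ`-edge is `(h, y₁)`, `(x₁, y₀)` or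
`(h, y₀)` — exactly the edges a shared row provides.  Hence the FIRST HUB FACE INEQUALITY
(`NoAccidental.volume_add_faces_YZ_XZ_le`)

  `|X₁||Y₁||Z₁| + |Y₂||Z₂| + |X₂||Z₂| ≤ |G|`,

and, with the mirrored images `y - z - x`, `(y - z) - h`, `y - z₀ - x` (`z₀ ∈ Z₁`), the SECOND
(`NoAccidental.volume_add_faces_YZ_XY_le`)

  `|X₁||Y₁||Z₁| + |Y₂||Z₂| + |X₂||Y₂| ≤ |G|`.

(The gen-77 face inequalities had one face of the other block on the left; the hub buys a second one.)
CONSEQUENCE (`NoAccidental.card_triangleSet_le_of_hub_two_two`, `…_of_hub_two_two'`, and the mirror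
`…_of_hub_two_twoZ`): if one block of an accidental-free hub pair has at most two rows and another side of size at
most two, then the whole configuration has at most `|G|` triangles — `pqr ≤ qr + pr` as soon as `p, q ≤ 2`.  Together
with `SoloInformedValTwoRowHubPair` (both blocks with two rows, any other sides) this settles the conjectured bound
`v₁ + v₂ ≤ |G|` ((U8*) for hub pairs) whenever some block has two rows and either the other block also has two rows
or the two-row block has a further side `≤ 2`.  In general the two inequalities give
`v₁ + v₂ ≤ |G| + (|X₂| - 1)|Y₂||Z₂| - |X₂| max(|Y₂|, |Z₂|)`; the smallest shape pairs left open are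
`(3,2,2)+(3,2,2)` (`24` triangles) and `(3,2,2)+(4,2,2)` (`28`), for both of which this reads `v₁ + v₂ ≤ |G| + 2`.

Elementary; no `sorry`.
-/

namespace Summit.MatrixMultiplication.MatrixMultiplication.Theorems.SoloVal

open Finset

section HubPairFaces

variable {G : Type*} [AddCommGroup G] [DecidableEq G]
variable {X₁ Y₁ Z₁ X₂ Y₂ Z₂ : Finset G} {h : G}

omit [AddCommGroup G] in
/-- The two-block pair graphs do not depend on the order of the blocks. -/
theorem blockPairs_comm (A B A' B' : Finset G) : blockPairs A B A' B' = blockPairs A' B' A B :=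
  Finset.union_comm _ _

omit [AddCommGroup G] in
/-- With `Y₁ ∩ Y₂ = ∅` and `Z₁ ∩ Z₂ = ∅` (the row classes may meet, as in a hub pair) the number of triangles of
the two-block pair graphs is `|X₁||Y₁||Z₁| + |X₂||Y₂||Z₂|`. -/
theorem card_triangleSet_blockPairs_of_disjoint (hY : Disjoint Y₁ Y₂) (hZ : Disjoint Z₁ Z₂) :
    (triangleSet (blockPairs X₁ Y₁ X₂ Y₂) (blockPairs Y₁ Z₁ Y₂ Z₂) (blockPairs Z₁ X₁ Z₂ X₂)).card =
      X₁.card * Y₁.card * Z₁.card + X₂.card * Y₂.card * Z₂.card := by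
  rw [triangleSet_blockPairs hY hZ]
  have hd : Disjoint (X₁ ×ˢ Y₁ ×ˢ Z₁) (X₂ ×ˢ Y₂ ×ˢ Z₂) := by
    rw [Finset.disjoint_left]
    rintro ⟨i, j, k⟩ h1 h2
    rw [Finset.mem_product, Finset.mem_product] at h1 h2
    exact Finset.disjoint_left.mp hY h1.2.1 h2.2.1
  rw [Finset.card_union_of_disjoint hd, Finset.card_product, Finset.card_product, Finset.card_product,
    Finset.card_product, Nat.mul_assoc, Nat.mul_assoc]

/-- FIRST HUB FACE INEQUALITY.  For an accidental-free pair of complete blocks with disjoint `J`- and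
`K`-classes, a common row `h ∈ X₁ ∩ X₂` and `Y₁, Y₂` non-empty:
`|X₁||Y₁||Z₁| + |Y₂||Z₂| + |X₂||Z₂| ≤ |G|`. -/
theorem NoAccidental.volume_add_faces_YZ_XZ_le [Fintype G]
    (hh₁ : h ∈ X₁) (hh₂ : h ∈ X₂) (hY : Disjoint Y₁ Y₂) (hZ : Disjoint Z₁ Z₂)
    (hY₁ : Y₁.Nonempty) (hY₂ : Y₂.Nonempty)
    (hN : NoAccidental (id : G → G) id id (blockPairs X₁ Y₁ X₂ Y₂) (blockPairs Y₁ Z₁ Y₂ Z₂)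
      (blockPairs Z₁ X₁ Z₂ X₂)) :
    X₁.card * Y₁.card * Z₁.card + Y₂.card * Z₂.card + X₂.card * Z₂.card ≤ Fintype.card G := by
  obtain ⟨y₀, hy₀⟩ := hY₁
  obtain ⟨yt, hyt⟩ := hY₂
  have hY' : ∀ ⦃u⦄, u ∈ Y₁ → u ∈ Y₂ → False := fun u h1 h2 => Finset.disjoint_left.mp hY h1 h2
  have hZ' : ∀ ⦃u⦄, u ∈ Z₁ → u ∈ Z₂ → False := fun u h1 h2 => Finset.disjoint_left.mp hZ h1 h2
  have eIJ₁ : ∀ {x y : G}, x ∈ X₁ → y ∈ Y₁ → (x, y) ∈ blockPairs X₁ Y₁ X₂ Y₂ :=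
    fun hx hy => mem_blockPairs.mpr (Or.inl ⟨hx, hy⟩)
  have eIJ₂ : ∀ {x y : G}, x ∈ X₂ → y ∈ Y₂ → (x, y) ∈ blockPairs X₁ Y₁ X₂ Y₂ :=
    fun hx hy => mem_blockPairs.mpr (Or.inr ⟨hx, hy⟩)
  have eJK₁ : ∀ {y z : G}, y ∈ Y₁ → z ∈ Z₁ → (y, z) ∈ blockPairs Y₁ Z₁ Y₂ Z₂ :=
    fun hy hz => mem_blockPairs.mpr (Or.inl ⟨hy, hz⟩)
  have eJK₂ : ∀ {y z : G}, y ∈ Y₂ → z ∈ Z₂ → (y, z) ∈ blockPairs Y₁ Z₁ Y₂ Z₂ :=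
    fun hy hz => mem_blockPairs.mpr (Or.inr ⟨hy, hz⟩)
  have eKI₁ : ∀ {z x : G}, z ∈ Z₁ → x ∈ X₁ → (z, x) ∈ blockPairs Z₁ X₁ Z₂ X₂ :=
    fun hz hx => mem_blockPairs.mpr (Or.inl ⟨hz, hx⟩)
  have eKI₂ : ∀ {z x : G}, z ∈ Z₂ → x ∈ X₂ → (z, x) ∈ blockPairs Z₁ X₁ Z₂ X₂ :=
    fun hz hx => mem_blockPairs.mpr (Or.inr ⟨hz, hx⟩)
  set S := (X₁ ×ˢ Y₁ ×ˢ Z₁).image (fun t => t.1 + t.2.1 - t.2.2) with hS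
  set P := (Y₂ ×ˢ Z₂).image (fun p => h + (p.1 - p.2)) with hP
  set N := (X₂ ×ˢ Z₂).image (fun p => p.1 + y₀ - p.2) with hN'
  -- the three cardinalities
  have hSc : S.card = X₁.card * Y₁.card * Z₁.card := by
    have hinj : Set.InjOn (fun t : G × G × G => t.1 + t.2.1 - t.2.2) ↑(X₁ ×ˢ Y₁ ×ˢ Z₁) := by
      rintro ⟨x, y, z⟩ hm ⟨x', y', z'⟩ hm' heq
      simp only [Finset.coe_product, Set.mem_prod, Finset.mem_coe] at hm hm'
      have heq' : x + y - z = x' + y' - z' := heq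
      have h0 : (x - y') + (y - z) + (z' - x') = 0 :=
        calc (x - y') + (y - z) + (z' - x') = (x + y - z) - (x' + y' - z') := by abel
          _ = 0 := by rw [heq', sub_self]
      obtain ⟨hx, hy, hz⟩ :=
        hN x y' y z z' x' (eIJ₁ hm.1 hm'.2.1) (eJK₁ hm.2.1 hm.2.2) (eKI₁ hm'.2.2 hm'.1) h0
      rw [hx, ← hy, hz]
    rw [Finset.card_image_of_injOn hinj, Finset.card_product, Finset.card_product, Nat.mul_assoc]
  have hPc : P.card = Y₂.card * Z₂.card := by
    have hinj : Set.InjOn (fun p : G × G => h + (p.1 - p.2)) ↑(Y₂ ×ˢ Z₂) := by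
      rintro ⟨y, z⟩ hm ⟨y', z'⟩ hm' heq
      simp only [Finset.coe_product, Set.mem_prod, Finset.mem_coe] at hm hm'
      have heq' : y - z = y' - z' := add_left_cancel heq
      have h0 : (h - y') + (y - z) + (z' - h) = 0 :=
        calc (h - y') + (y - z) + (z' - h) = (y - z) - (y' - z') := by abel
          _ = 0 := by rw [heq', sub_self]
      obtain ⟨-, hy, hz⟩ := hN h y' y z z' h (eIJ₂ hh₂ hm'.1) (eJK₂ hm.1 hm.2) (eKI₂ hm'.2 hh₂) h0
      rw [← hy, hz]
    rw [Finset.card_image_of_injOn hinj, Finset.card_product]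
  have hNc : N.card = X₂.card * Z₂.card := by
    have hinj : Set.InjOn (fun p : G × G => p.1 + y₀ - p.2) ↑(X₂ ×ˢ Z₂) := by
      rintro ⟨x, z⟩ hm ⟨x', z'⟩ hm' heq
      simp only [Finset.coe_product, Set.mem_prod, Finset.mem_coe] at hm hm'
      have heq' : x + y₀ - z = x' + y₀ - z' := heq
      have h0 : (x - yt) + (yt - z) + (z' - x') = 0 :=
        calc (x - yt) + (yt - z) + (z' - x') = (x + y₀ - z) - (x' + y₀ - z') := by abel
          _ = 0 := by rw [heq', sub_self]
      obtain ⟨hx, -, hz⟩ := hN x yt yt z z' x' (eIJ₂ hm.1 hyt) (eJK₂ hyt hm.2) (eKI₂ hm'.2 hm'.1) h0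
      rw [hx, hz]
    rw [Finset.card_image_of_injOn hinj, Finset.card_product]
  -- pairwise disjointness: each coincidence is an accidental solution through an edge at the hub or at `y₀`
  have hSP : Disjoint S P := by
    rw [Finset.disjoint_left]
    intro g hgS hgP
    rw [hS, Finset.mem_image] at hgS
    rw [hP, Finset.mem_image] at hgP
    obtain ⟨⟨x₁, y₁, z₁⟩, hm, rfl⟩ := hgS
    obtain ⟨⟨y₂, z₂⟩, hm', heq⟩ := hgP
    simp only [Finset.mem_product] at hm hm'
    have heq' : h + (y₂ - z₂) = x₁ + y₁ - z₁ := heq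
    have h0 : (h - y₁) + (y₂ - z₂) + (z₁ - x₁) = 0 :=
      calc (h - y₁) + (y₂ - z₂) + (z₁ - x₁) = (h + (y₂ - z₂)) - (x₁ + y₁ - z₁) := by abel
        _ = 0 := by rw [heq', sub_self]
    have hc := hN h y₁ y₂ z₂ z₁ x₁ (eIJ₁ hh₁ hm.2.1) (eJK₂ hm'.1 hm'.2) (eKI₁ hm.2.2 hm.1) h0
    exact hY' hm.2.1 (hc.2.1 ▸ hm'.1)
  have hSN : Disjoint S N := by
    rw [Finset.disjoint_left]
    intro g hgS hgN
    rw [hS, Finset.mem_image] at hgS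
    rw [hN', Finset.mem_image] at hgN
    obtain ⟨⟨x₁, y₁, z₁⟩, hm, rfl⟩ := hgS
    obtain ⟨⟨x₂, z₂⟩, hm', heq⟩ := hgN
    simp only [Finset.mem_product] at hm hm'
    have heq' : x₂ + y₀ - z₂ = x₁ + y₁ - z₁ := heq
    have h0 : (x₁ - y₀) + (y₁ - z₁) + (z₂ - x₂) = 0 :=
      calc (x₁ - y₀) + (y₁ - z₁) + (z₂ - x₂) = (x₁ + y₁ - z₁) - (x₂ + y₀ - z₂) := by abel
        _ = 0 := by rw [← heq', sub_self]
    have hc := hN x₁ y₀ y₁ z₁ z₂ x₂ (eIJ₁ hm.1 hy₀) (eJK₁ hm.2.1 hm.2.2) (eKI₂ hm'.2 hm'.1) h0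
    exact hZ' hm.2.2 (hc.2.2 ▸ hm'.2)
  have hPN : Disjoint P N := by
    rw [Finset.disjoint_left]
    intro g hgP hgN
    rw [hP, Finset.mem_image] at hgP
    rw [hN', Finset.mem_image] at hgN
    obtain ⟨⟨y₂, z₂⟩, hm, rfl⟩ := hgP
    obtain ⟨⟨x₂, z₂'⟩, hm', heq⟩ := hgN
    simp only [Finset.mem_product] at hm hm'
    have heq' : x₂ + y₀ - z₂' = h + (y₂ - z₂) := heq
    have h0 : (h - y₀) + (y₂ - z₂) + (z₂' - x₂) = 0 :=
      calc (h - y₀) + (y₂ - z₂) + (z₂' - x₂) = (h + (y₂ - z₂)) - (x₂ + y₀ - z₂') := by abel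
        _ = 0 := by rw [← heq', sub_self]
    have hc := hN h y₀ y₂ z₂ z₂' x₂ (eIJ₁ hh₁ hy₀) (eJK₂ hm.1 hm.2) (eKI₂ hm'.2 hm'.1) h0
    exact hY' hy₀ (hc.2.1 ▸ hm.1)
  have hU : (S ∪ P ∪ N).card = S.card + P.card + N.card := by
    rw [Finset.card_union_of_disjoint (Finset.disjoint_union_left.mpr ⟨hSN, hPN⟩),
      Finset.card_union_of_disjoint hSP]
  calc X₁.card * Y₁.card * Z₁.card + Y₂.card * Z₂.card + X₂.card * Z₂.card = (S ∪ P ∪ N).card := by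
        rw [hU, hSc, hPc, hNc]
    _ ≤ Fintype.card G := Finset.card_le_univ _

/-- SECOND HUB FACE INEQUALITY (the mirror images `y - z - x`, `(y - z) - h`, `y - z₀ - x`).  For an
accidental-free pair of complete blocks with disjoint `J`- and `K`-classes, a common row `h ∈ X₁ ∩ X₂` and
`Z₁, Z₂` non-empty: `|X₁||Y₁||Z₁| + |Y₂||Z₂| + |X₂||Y₂| ≤ |G|`. -/
theorem NoAccidental.volume_add_faces_YZ_XY_le [Fintype G]
    (hh₁ : h ∈ X₁) (hh₂ : h ∈ X₂) (hY : Disjoint Y₁ Y₂) (hZ : Disjoint Z₁ Z₂)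
    (hZ₁ : Z₁.Nonempty) (hZ₂ : Z₂.Nonempty)
    (hN : NoAccidental (id : G → G) id id (blockPairs X₁ Y₁ X₂ Y₂) (blockPairs Y₁ Z₁ Y₂ Z₂)
      (blockPairs Z₁ X₁ Z₂ X₂)) :
    X₁.card * Y₁.card * Z₁.card + Y₂.card * Z₂.card + X₂.card * Y₂.card ≤ Fintype.card G := by
  obtain ⟨z₀, hz₀⟩ := hZ₁
  obtain ⟨zt, hzt⟩ := hZ₂
  have hY' : ∀ ⦃u⦄, u ∈ Y₁ → u ∈ Y₂ → False := fun u h1 h2 => Finset.disjoint_left.mp hY h1 h2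
  have hZ' : ∀ ⦃u⦄, u ∈ Z₁ → u ∈ Z₂ → False := fun u h1 h2 => Finset.disjoint_left.mp hZ h1 h2
  have eIJ₁ : ∀ {x y : G}, x ∈ X₁ → y ∈ Y₁ → (x, y) ∈ blockPairs X₁ Y₁ X₂ Y₂ :=
    fun hx hy => mem_blockPairs.mpr (Or.inl ⟨hx, hy⟩)
  have eIJ₂ : ∀ {x y : G}, x ∈ X₂ → y ∈ Y₂ → (x, y) ∈ blockPairs X₁ Y₁ X₂ Y₂ :=
    fun hx hy => mem_blockPairs.mpr (Or.inr ⟨hx, hy⟩)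
  have eJK₁ : ∀ {y z : G}, y ∈ Y₁ → z ∈ Z₁ → (y, z) ∈ blockPairs Y₁ Z₁ Y₂ Z₂ :=
    fun hy hz => mem_blockPairs.mpr (Or.inl ⟨hy, hz⟩)
  have eJK₂ : ∀ {y z : G}, y ∈ Y₂ → z ∈ Z₂ → (y, z) ∈ blockPairs Y₁ Z₁ Y₂ Z₂ :=
    fun hy hz => mem_blockPairs.mpr (Or.inr ⟨hy, hz⟩)
  have eKI₁ : ∀ {z x : G}, z ∈ Z₁ → x ∈ X₁ → (z, x) ∈ blockPairs Z₁ X₁ Z₂ X₂ :=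
    fun hz hx => mem_blockPairs.mpr (Or.inl ⟨hz, hx⟩)
  have eKI₂ : ∀ {z x : G}, z ∈ Z₂ → x ∈ X₂ → (z, x) ∈ blockPairs Z₁ X₁ Z₂ X₂ :=
    fun hz hx => mem_blockPairs.mpr (Or.inr ⟨hz, hx⟩)
  set S := (X₁ ×ˢ Y₁ ×ˢ Z₁).image (fun t => t.2.1 - t.2.2 - t.1) with hS
  set P := (Y₂ ×ˢ Z₂).image (fun p => (p.1 - p.2) - h) with hP
  set N := (X₂ ×ˢ Y₂).image (fun p => p.2 - z₀ - p.1) with hN'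
  have hSc : S.card = X₁.card * Y₁.card * Z₁.card := by
    have hinj : Set.InjOn (fun t : G × G × G => t.2.1 - t.2.2 - t.1) ↑(X₁ ×ˢ Y₁ ×ˢ Z₁) := by
      rintro ⟨x, y, z⟩ hm ⟨x', y', z'⟩ hm' heq
      simp only [Finset.coe_product, Set.mem_prod, Finset.mem_coe] at hm hm'
      have heq' : y - z - x = y' - z' - x' := heq
      have h0 : (x' - y') + (y - z) + (z' - x) = 0 :=
        calc (x' - y') + (y - z) + (z' - x) = (y - z - x) - (y' - z' - x') := by abel
          _ = 0 := by rw [heq', sub_self]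
      obtain ⟨hx, hy, hz⟩ :=
        hN x' y' y z z' x (eIJ₁ hm'.1 hm'.2.1) (eJK₁ hm.2.1 hm.2.2) (eKI₁ hm'.2.2 hm.1) h0
      rw [← hx, ← hy, hz]
    rw [Finset.card_image_of_injOn hinj, Finset.card_product, Finset.card_product, Nat.mul_assoc]
  have hPc : P.card = Y₂.card * Z₂.card := by
    have hinj : Set.InjOn (fun p : G × G => (p.1 - p.2) - h) ↑(Y₂ ×ˢ Z₂) := by
      rintro ⟨y, z⟩ hm ⟨y', z'⟩ hm' heq
      simp only [Finset.coe_product, Set.mem_prod, Finset.mem_coe] at hm hm'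
      have heq' : y - z = y' - z' := sub_left_inj.mp heq
      have h0 : (h - y') + (y - z) + (z' - h) = 0 :=
        calc (h - y') + (y - z) + (z' - h) = (y - z) - (y' - z') := by abel
          _ = 0 := by rw [heq', sub_self]
      obtain ⟨-, hy, hz⟩ := hN h y' y z z' h (eIJ₂ hh₂ hm'.1) (eJK₂ hm.1 hm.2) (eKI₂ hm'.2 hh₂) h0
      rw [← hy, hz]
    rw [Finset.card_image_of_injOn hinj, Finset.card_product]
  have hNc : N.card = X₂.card * Y₂.card := by
    have hinj : Set.InjOn (fun p : G × G => p.2 - z₀ - p.1) ↑(X₂ ×ˢ Y₂) := by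
      rintro ⟨x, y⟩ hm ⟨x', y'⟩ hm' heq
      simp only [Finset.coe_product, Set.mem_prod, Finset.mem_coe] at hm hm'
      have heq' : y - z₀ - x = y' - z₀ - x' := heq
      have h0 : (x' - y') + (y - zt) + (zt - x) = 0 :=
        calc (x' - y') + (y - zt) + (zt - x) = (y - z₀ - x) - (y' - z₀ - x') := by abel
          _ = 0 := by rw [heq', sub_self]
      obtain ⟨hx, hy, -⟩ := hN x' y' y zt zt x (eIJ₂ hm'.1 hm'.2) (eJK₂ hm.2 hzt) (eKI₂ hzt hm.1) h0
      rw [← hx, ← hy]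
    rw [Finset.card_image_of_injOn hinj, Finset.card_product]
  have hSP : Disjoint S P := by
    rw [Finset.disjoint_left]
    intro g hgS hgP
    rw [hS, Finset.mem_image] at hgS
    rw [hP, Finset.mem_image] at hgP
    obtain ⟨⟨x₁, y₁, z₁⟩, hm, rfl⟩ := hgS
    obtain ⟨⟨y₂, z₂⟩, hm', heq⟩ := hgP
    simp only [Finset.mem_product] at hm hm'
    have heq' : (y₂ - z₂) - h = y₁ - z₁ - x₁ := heq
    have h0 : (x₁ - y₁) + (y₂ - z₂) + (z₁ - h) = 0 :=
      calc (x₁ - y₁) + (y₂ - z₂) + (z₁ - h) = ((y₂ - z₂) - h) - (y₁ - z₁ - x₁) := by abel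
        _ = 0 := by rw [heq', sub_self]
    have hc := hN x₁ y₁ y₂ z₂ z₁ h (eIJ₁ hm.1 hm.2.1) (eJK₂ hm'.1 hm'.2) (eKI₁ hm.2.2 hh₁) h0
    exact hY' hm.2.1 (hc.2.1 ▸ hm'.1)
  have hSN : Disjoint S N := by
    rw [Finset.disjoint_left]
    intro g hgS hgN
    rw [hS, Finset.mem_image] at hgS
    rw [hN', Finset.mem_image] at hgN
    obtain ⟨⟨x₁, y₁, z₁⟩, hm, rfl⟩ := hgS
    obtain ⟨⟨x₂, y₂⟩, hm', heq⟩ := hgN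
    simp only [Finset.mem_product] at hm hm'
    have heq' : y₂ - z₀ - x₂ = y₁ - z₁ - x₁ := heq
    have h0 : (x₂ - y₂) + (y₁ - z₁) + (z₀ - x₁) = 0 :=
      calc (x₂ - y₂) + (y₁ - z₁) + (z₀ - x₁) = (y₁ - z₁ - x₁) - (y₂ - z₀ - x₂) := by abel
        _ = 0 := by rw [← heq', sub_self]
    have hc := hN x₂ y₂ y₁ z₁ z₀ x₁ (eIJ₂ hm'.1 hm'.2) (eJK₁ hm.2.1 hm.2.2) (eKI₁ hz₀ hm.1) h0
    exact hY' hm.2.1 (hc.2.1 ▸ hm'.2)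
  have hPN : Disjoint P N := by
    rw [Finset.disjoint_left]
    intro g hgP hgN
    rw [hP, Finset.mem_image] at hgP
    rw [hN', Finset.mem_image] at hgN
    obtain ⟨⟨y₂, z₂⟩, hm, rfl⟩ := hgP
    obtain ⟨⟨x₂, y₂'⟩, hm', heq⟩ := hgN
    simp only [Finset.mem_product] at hm hm'
    have heq' : y₂' - z₀ - x₂ = (y₂ - z₂) - h := heq
    have h0 : (x₂ - y₂') + (y₂ - z₂) + (z₀ - h) = 0 :=
      calc (x₂ - y₂') + (y₂ - z₂) + (z₀ - h) = ((y₂ - z₂) - h) - (y₂' - z₀ - x₂) := by abel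
        _ = 0 := by rw [← heq', sub_self]
    have hc := hN x₂ y₂' y₂ z₂ z₀ h (eIJ₂ hm'.1 hm'.2) (eJK₂ hm.1 hm.2) (eKI₁ hz₀ hh₁) h0
    exact hZ' hz₀ (hc.2.2 ▸ hm.2)
  have hU : (S ∪ P ∪ N).card = S.card + P.card + N.card := by
    rw [Finset.card_union_of_disjoint (Finset.disjoint_union_left.mpr ⟨hSN, hPN⟩),
      Finset.card_union_of_disjoint hSP]
  calc X₁.card * Y₁.card * Z₁.card + Y₂.card * Z₂.card + X₂.card * Y₂.card = (S ∪ P ∪ N).card := by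
        rw [hU, hSc, hPc, hNc]
    _ ≤ Fintype.card G := Finset.card_le_univ _

/-- Arithmetic: `p q ≤ p + q` for `p, q ≤ 2`. -/
theorem mul_le_add_of_le_two {p q : ℕ} (hp : p ≤ 2) (hq : q ≤ 2) : p * q ≤ p + q := by
  obtain rfl | rfl | rfl : p = 0 ∨ p = 1 ∨ p = 2 := by omega
  all_goals omega

/-- A TWO-ROW BLOCK WITH AT MOST TWO `J`-VERTICES PACKS LINEARLY AGAINST ANYTHING: in an accidental-free hub pair
(disjoint `J`- and `K`-classes, a common row, `Y₁, Y₂` non-empty) with `|X₂| ≤ 2` and `|Y₂| ≤ 2` the number of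
triangles is at most `|G|` — whatever the shape of the first block. -/
theorem NoAccidental.card_triangleSet_le_of_hub_two_two [Fintype G]
    (hh₁ : h ∈ X₁) (hh₂ : h ∈ X₂) (hY : Disjoint Y₁ Y₂) (hZ : Disjoint Z₁ Z₂)
    (hY₁ : Y₁.Nonempty) (hY₂ : Y₂.Nonempty)
    (hN : NoAccidental (id : G → G) id id (blockPairs X₁ Y₁ X₂ Y₂) (blockPairs Y₁ Z₁ Y₂ Z₂)
      (blockPairs Z₁ X₁ Z₂ X₂))
    (hp : X₂.card ≤ 2) (hq : Y₂.card ≤ 2) :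
    (triangleSet (blockPairs X₁ Y₁ X₂ Y₂) (blockPairs Y₁ Z₁ Y₂ Z₂) (blockPairs Z₁ X₁ Z₂ X₂)).card ≤
      Fintype.card G := by
  rw [card_triangleSet_blockPairs_of_disjoint hY hZ]
  have hf := hN.volume_add_faces_YZ_XZ_le hh₁ hh₂ hY hZ hY₁ hY₂
  have hv : X₂.card * Y₂.card * Z₂.card ≤ Y₂.card * Z₂.card + X₂.card * Z₂.card :=
    calc X₂.card * Y₂.card * Z₂.card ≤ (X₂.card + Y₂.card) * Z₂.card :=
          Nat.mul_le_mul_right _ (mul_le_add_of_le_two hp hq)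
      _ = Y₂.card * Z₂.card + X₂.card * Z₂.card := by rw [Nat.add_mul, Nat.add_comm]
  omega

/-- The mirror consequence: `|X₂| ≤ 2` and `|Z₂| ≤ 2` (with `Z₁, Z₂` non-empty) also force at most `|G|`
triangles. -/
theorem NoAccidental.card_triangleSet_le_of_hub_two_twoZ [Fintype G]
    (hh₁ : h ∈ X₁) (hh₂ : h ∈ X₂) (hY : Disjoint Y₁ Y₂) (hZ : Disjoint Z₁ Z₂)
    (hZ₁ : Z₁.Nonempty) (hZ₂ : Z₂.Nonempty)
    (hN : NoAccidental (id : G → G) id id (blockPairs X₁ Y₁ X₂ Y₂) (blockPairs Y₁ Z₁ Y₂ Z₂)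
      (blockPairs Z₁ X₁ Z₂ X₂))
    (hp : X₂.card ≤ 2) (hr : Z₂.card ≤ 2) :
    (triangleSet (blockPairs X₁ Y₁ X₂ Y₂) (blockPairs Y₁ Z₁ Y₂ Z₂) (blockPairs Z₁ X₁ Z₂ X₂)).card ≤
      Fintype.card G := by
  rw [card_triangleSet_blockPairs_of_disjoint hY hZ]
  have hf := hN.volume_add_faces_YZ_XY_le hh₁ hh₂ hY hZ hZ₁ hZ₂
  have hv : X₂.card * Y₂.card * Z₂.card ≤ Y₂.card * Z₂.card + X₂.card * Y₂.card :=
    calc X₂.card * Y₂.card * Z₂.card = X₂.card * Z₂.card * Y₂.card := Nat.mul_right_comm _ _ _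
      _ ≤ (X₂.card + Z₂.card) * Y₂.card := Nat.mul_le_mul_right _ (mul_le_add_of_le_two hp hr)
      _ = Y₂.card * Z₂.card + X₂.card * Y₂.card := by
          rw [Nat.add_mul, Nat.mul_comm Z₂.card Y₂.card, Nat.add_comm]
  omega

/-- The same with the roles of the blocks exchanged: `|X₁| ≤ 2` and `|Y₁| ≤ 2` force at most `|G|` triangles. -/
theorem NoAccidental.card_triangleSet_le_of_hub_two_two' [Fintype G]
    (hh₁ : h ∈ X₁) (hh₂ : h ∈ X₂) (hY : Disjoint Y₁ Y₂) (hZ : Disjoint Z₁ Z₂)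
    (hY₁ : Y₁.Nonempty) (hY₂ : Y₂.Nonempty)
    (hN : NoAccidental (id : G → G) id id (blockPairs X₁ Y₁ X₂ Y₂) (blockPairs Y₁ Z₁ Y₂ Z₂)
      (blockPairs Z₁ X₁ Z₂ X₂))
    (hp : X₁.card ≤ 2) (hq : Y₁.card ≤ 2) :
    (triangleSet (blockPairs X₁ Y₁ X₂ Y₂) (blockPairs Y₁ Z₁ Y₂ Z₂) (blockPairs Z₁ X₁ Z₂ X₂)).card ≤
      Fintype.card G := by
  rw [blockPairs_comm X₁ Y₁, blockPairs_comm Y₁ Z₁, blockPairs_comm Z₁ X₁] at hN ⊢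
  exact hN.card_triangleSet_le_of_hub_two_two hh₂ hh₁ hY.symm hZ.symm hY₂ hY₁ hp hq

end HubPairFaces

end Summit.MatrixMultiplication.MatrixMultiplication.Theorems.SoloVal
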